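/-
BALABAN–IMBRIE–JAFFE 1988 (CMP 114), §5.13 p.305–306 [PDF 49–50].  The smooth factors `f(□_i)_s` (bounded smooth
functions of the fields, with bounded derivatives) are what the trains `δ/δΦ C_s □Δ□ C_s ⋯ (½ δ/δΦ + ℱ)` of the walk
form (5.13.3) act on: «integration by parts replaces Φ by C_s(δ/δΦ) + C_s f … Each Φ contracts through a C_s to
another Φ, to an f(□_i)_s or to ℱ».  Deriving (5.13.3) at every order rearranges ITERATED directional derivatives of
the smooth factor freely (the order in which the fields are integrated by parts is immaterial) and sums them over
the sites of the walks; this file supplies that calculus for the class `𝒞` of smooth factors of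
`BIJ88WickSourceSmooth305.wick_source_smooth` (C¹, bounded, bounded derivative, closed under directional derivatives),
here taken to be a linear subspace (no loss: `isSmoothClass_span`).

THE CALCULUS OF THE SMOOTH FACTORS:

* `Nice`, `IsSmoothClass` — the regularity, and a linear class of such factors closed under `∂_u`;
* `IsSmoothClass.contDiff_two`, `IsSmoothClass.fderiv_fderiv_comm` — members are C², mixed second directional
  derivatives commute (Schwarz, via Mathlib's `second_derivative_symmetric`);
* `dset_congr`, `dset_singleton`, `IsSmoothClass.dset_mem/dset_add/dset_smul/dset_sum` — the iterated derivative
  `dset u D` of `BIJ88WickSourceSmooth305` (largest leg innermost) preserves the class and is linear on it;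
* `IsSmoothClass.dset_fderiv_comm/dset_insert/dset_union/dset_pair` — ORDER-INDEPENDENCE: `∂_{u_D}` commutes with
  every `∂_w`; adding a leg anywhere = first differentiating along it; `∂_{u_{D₁⊔D₂}} = ∂_{u_{D₁}} ∂_{u_{D₂}}`;
* `IsSmoothClass.dset_update_sum` — linearity in each direction (summing a direction over lattice sites);
* `fderiv_eq_sum_single`, `IsSmoothClass.fderiv_fderiv_eq_sum` — coordinates: `∂_w G = Σ_q w_q ∂_q G`,
  `∂_v∂_w G = Σ_{p,q} v_p w_q ∂_p∂_q G`;
* `isSmoothClass_span` — the linear span of a class with the hypotheses `hC`, `hD` of `wick_source_smooth` is an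
  `IsSmoothClass`.

statement-level skeleton of published theorems with citation tags; proofs where landed; nothing here is a claim
about the Yang–Mills mass gap

PDF held: `paper:balaban1988-cmp114-bij-abelian-higgs-effective-action` (journal page = PDF page + 256).

## References

* [BalabanImbrieJaffe1988] T. Bałaban, J. Imbrie, A. Jaffe, *Effective action and cluster properties of the abelian
  Higgs model*, Comm. Math. Phys. 114 (1988) 257–315, §5.13 p.305–306.
-/
import Literature.MathematicalPhysics.QuantumFieldTheory.BalabanImbrieJaffe1984to88.BIJ88WickSourceSmooth305

namespace Literature.MathematicalPhysics.QuantumFieldTheory.BalabanImbrieJaffe1984to88.BIJ88SmoothClassCalculus306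

open Finset Function
open scoped BigOperators
open BIJ88WickSourceSmooth305 (dset dset_empty dset_insert_max)

variable {S : Type} [Fintype S] [DecidableEq S]

/-! ## §1  The class of smooth factors -/

/-- The regularity of a smooth factor `f(□_i)_s`: C¹, bounded, with bounded derivative (the hypothesis `hC` of
`BIJ88WickSourceSmooth305.wick_source_smooth`). [cite: BalabanImbrieJaffe1988, §5.13 p.305] -/
def Nice (G : (S → ℝ) → ℝ) : Prop :=
  ContDiff ℝ 1 G ∧ (∃ K₀ : ℝ, ∀ φ, ‖G φ‖ ≤ K₀) ∧ ∃ K₁ : ℝ, ∀ φ, ‖fderiv ℝ G φ‖ ≤ K₁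

omit [DecidableEq S] in
/-- The zero factor is nice. [cite: BalabanImbrieJaffe1988, §5.13 p.305] -/
theorem nice_zero : Nice (0 : (S → ℝ) → ℝ) := by
  refine ⟨contDiff_const (c := (0 : ℝ)), ⟨0, fun φ => by simp⟩, ⟨0, fun φ => ?_⟩⟩
  rw [fderiv_zero]
  simp

omit [DecidableEq S] in
/-- Sums of nice factors are nice. [cite: BalabanImbrieJaffe1988, §5.13 p.305] -/
theorem Nice.add {G G' : (S → ℝ) → ℝ} (hG : Nice G) (hG' : Nice G') : Nice (G + G') := by
  obtain ⟨h1, ⟨K₀, h0⟩, ⟨K₁, h1'⟩⟩ := hG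
  obtain ⟨g1, ⟨L₀, g0⟩, ⟨L₁, g1'⟩⟩ := hG'
  refine ⟨h1.add g1, ⟨K₀ + L₀, fun φ => (norm_add_le _ _).trans (add_le_add (h0 φ) (g0 φ))⟩, ⟨K₁ + L₁, fun φ => ?_⟩⟩
  rw [fderiv_add (h1.differentiable one_ne_zero φ) (g1.differentiable one_ne_zero φ)]
  exact (norm_add_le _ _).trans (add_le_add (h1' φ) (g1' φ))

omit [DecidableEq S] in
/-- Multiples of nice factors are nice. [cite: BalabanImbrieJaffe1988, §5.13 p.305] -/
theorem Nice.smul {G : (S → ℝ) → ℝ} (hG : Nice G) (a : ℝ) : Nice (a • G) := by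
  obtain ⟨h1, ⟨K₀, h0⟩, ⟨K₁, h1'⟩⟩ := hG
  refine ⟨h1.const_smul a, ⟨‖a‖ * K₀, fun φ => ?_⟩, ⟨‖a‖ * K₁, fun φ => ?_⟩⟩
  · rw [Pi.smul_apply, norm_smul]
    exact mul_le_mul_of_nonneg_left (h0 φ) (norm_nonneg a)
  · rw [fderiv_const_smul (h1.differentiable one_ne_zero φ), norm_smul]
    exact mul_le_mul_of_nonneg_left (h1' φ) (norm_nonneg a)

/-- **A linear class of smooth factors**: a subspace of nice functions of the fields closed under directional
derivatives (the hypotheses `hC`, `hD` of `wick_source_smooth`, on a subspace).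
[cite: BalabanImbrieJaffe1988, §5.13 p.305] -/
structure IsSmoothClass (𝒞 : Submodule ℝ ((S → ℝ) → ℝ)) : Prop where
  nice : ∀ G ∈ 𝒞, Nice G
  fderiv_mem : ∀ G ∈ 𝒞, ∀ u : S → ℝ, (fun φ => fderiv ℝ G φ u) ∈ 𝒞

omit [DecidableEq S] in
/-- **No loss of generality**: the linear span of any class of nice factors closed under directional derivatives is
a linear class of smooth factors. [cite: BalabanImbrieJaffe1988, §5.13 p.305] -/
theorem isSmoothClass_span (𝒞₀ : ((S → ℝ) → ℝ) → Prop) (hC : ∀ G, 𝒞₀ G → Nice G)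
    (hD : ∀ G (u : S → ℝ), 𝒞₀ G → 𝒞₀ (fun φ => fderiv ℝ G φ u)) :
    IsSmoothClass (Submodule.span ℝ {G | 𝒞₀ G}) := by
  have hnice : ∀ G ∈ Submodule.span ℝ {G | 𝒞₀ G}, Nice G := by
    intro G hG
    induction hG using Submodule.span_induction with
    | mem G hG => exact hC G hG
    | zero => exact nice_zero
    | add G G' _ _ hG hG' => exact hG.add hG'
    | smul a G _ hG => exact hG.smul a
  refine ⟨hnice, fun G hG u => ?_⟩
  induction hG using Submodule.span_induction with
  | mem G hG => exact Submodule.subset_span (hD G u hG)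
  | zero =>
    have : (fun φ : S → ℝ => fderiv ℝ (0 : (S → ℝ) → ℝ) φ u) = 0 := by
      funext φ
      rw [fderiv_zero]
      rfl
    rw [this]
    exact Submodule.zero_mem _
  | add G G' hG hG' ih ih' =>
    have : (fun φ => fderiv ℝ (G + G') φ u) = (fun φ => fderiv ℝ G φ u) + fun φ => fderiv ℝ G' φ u := by
      funext φ
      rw [fderiv_add ((hnice G hG).1.differentiable one_ne_zero φ) ((hnice G' hG').1.differentiable one_ne_zero φ)]
      rfl
    rw [this]
    exact Submodule.add_mem _ ih ih'
  | smul a G hG ih =>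
    have : (fun φ => fderiv ℝ (a • G) φ u) = a • fun φ => fderiv ℝ G φ u := by
      funext φ
      rw [fderiv_const_smul ((hnice G hG).1.differentiable one_ne_zero φ)]
      rfl
    rw [this]
    exact Submodule.smul_mem _ a ih

/-! ## §2  Second derivatives commute on the class -/

namespace IsSmoothClass

variable {𝒞 : Submodule ℝ ((S → ℝ) → ℝ)}

omit [DecidableEq S] in
/-- Members are differentiable. [cite: BalabanImbrieJaffe1988, §5.13 p.305] -/
theorem differentiable (h𝒞 : IsSmoothClass 𝒞) {G : (S → ℝ) → ℝ} (hG : G ∈ 𝒞) : Differentiable ℝ G :=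
  (h𝒞.nice G hG).1.differentiable one_ne_zero

omit [DecidableEq S] in
/-- Members are C² (their directional derivatives are again C¹). [cite: BalabanImbrieJaffe1988, §5.13 p.305] -/
theorem contDiff_two (h𝒞 : IsSmoothClass 𝒞) {G : (S → ℝ) → ℝ} (hG : G ∈ 𝒞) : ContDiff ℝ 2 G := by
  have h2 : (2 : WithTop ℕ∞) = 1 + 1 := by norm_num
  rw [h2, contDiff_succ_iff_fderiv]
  refine ⟨h𝒞.differentiable hG, fun h => absurd h (by simp), ?_⟩
  rw [contDiff_clm_apply_iff]
  intro u
  exact (h𝒞.nice _ (h𝒞.fderiv_mem G hG u)).1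

omit [DecidableEq S] in
/-- **Schwarz**: mixed second directional derivatives of a member commute.
[cite: BalabanImbrieJaffe1988, §5.13 p.306] -/
theorem fderiv_fderiv_comm (h𝒞 : IsSmoothClass 𝒞) {G : (S → ℝ) → ℝ} (hG : G ∈ 𝒞) (v w φ : S → ℝ) :
    fderiv ℝ (fun ψ => fderiv ℝ G ψ w) φ v = fderiv ℝ (fun ψ => fderiv ℝ G ψ v) φ w := by
  have hd : Differentiable ℝ (fderiv ℝ G) :=
    ((h𝒞.contDiff_two hG).fderiv_right (m := 1) (by norm_num)).differentiable one_ne_zero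
  have key : ∀ a b : S → ℝ, fderiv ℝ (fun ψ => fderiv ℝ G ψ a) φ b = fderiv ℝ (fderiv ℝ G) φ b a := by
    intro a b
    rw [fderiv_clm_apply (hd φ) (differentiableAt_const a), fderiv_fun_const]
    simp
  rw [key, key]
  exact second_derivative_symmetric (fun y => (h𝒞.differentiable hG y).hasFDerivAt) (hd φ).hasFDerivAt v w

end IsSmoothClass

/-! ## §3  The iterated derivative `dset`: structural facts -/

section Structural

variable {κ : Type} [LinearOrder κ]

omit [Fintype S] [DecidableEq S] in
/-- `∂_{u_D}` depends only on the directions of the legs in `D`. [cite: BalabanImbrieJaffe1988, §5.13 p.306] -/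
theorem dset_congr {u u' : κ → S → ℝ} {D : Finset κ} (h : ∀ j ∈ D, u j = u' j) (G : (S → ℝ) → ℝ) :
    dset u D G = dset u' D G := by
  induction D using Finset.induction_on_max generalizing G with
  | empty => rw [dset_empty, dset_empty]
  | insert a s ha ih =>
    rw [dset_insert_max u ha, dset_insert_max u' ha, h a (mem_insert_self a s),
      ih (fun j hj => h j (mem_insert_of_mem hj))]

omit [Fintype S] [DecidableEq S] in
/-- One leg: `∂_{u_{{j}}} G = ∂_{u_j} G`. [cite: BalabanImbrieJaffe1988, §5.13 p.306] -/
theorem dset_singleton (u : κ → S → ℝ) (j : κ) (G : (S → ℝ) → ℝ) :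
    dset u {j} G = fun φ => fderiv ℝ G φ (u j) := by
  rw [← Finset.insert_empty, dset_insert_max u (fun x hx => (notMem_empty x hx).elim), dset_empty]

omit [Fintype S] [DecidableEq S] in
/-- Adding a leg BELOW all others differentiates last (outermost): `∂_{u_{D∪{j}}} G = ∂_{u_j}(∂_{u_D} G)` (`j < D`);
no smoothness needed. [cite: BalabanImbrieJaffe1988, §5.13 p.306] -/
theorem dset_insert_min (u : κ → S → ℝ) {D : Finset κ} {j : κ} (hj : ∀ x ∈ D, j < x) (G : (S → ℝ) → ℝ) :
    dset u (insert j D) G = fun φ => fderiv ℝ (dset u D G) φ (u j) := by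
  induction D using Finset.induction_on_max generalizing G with
  | empty => rw [Finset.insert_empty, dset_singleton, dset_empty]
  | insert a s ha ih =>
    have hja : j < a := hj a (mem_insert_self a s)
    have ha' : ∀ x ∈ insert j s, x < a := by
      intro x hx
      rcases mem_insert.1 hx with rfl | hx
      · exact hja
      · exact ha x hx
    rw [Finset.insert_comm, dset_insert_max u ha', ih (fun x hx => hj x (mem_insert_of_mem hx)),
      dset_insert_max u ha]

end Structural

/-! ## §4  The iterated derivative on the class: linearity and order-independence -/

namespace IsSmoothClass

variable {𝒞 : Submodule ℝ ((S → ℝ) → ℝ)} {κ : Type} [LinearOrder κ]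

omit [DecidableEq S] in
/-- `∂_{u_D}` preserves the class. [cite: BalabanImbrieJaffe1988, §5.13 p.306] -/
theorem dset_mem (h𝒞 : IsSmoothClass 𝒞) (u : κ → S → ℝ) (D : Finset κ) {G : (S → ℝ) → ℝ} (hG : G ∈ 𝒞) :
    dset u D G ∈ 𝒞 := by
  induction D using Finset.induction_on_max generalizing G with
  | empty => rwa [dset_empty]
  | insert a s ha ih =>
    rw [dset_insert_max u ha]
    exact ih (h𝒞.fderiv_mem G hG (u a))

omit [DecidableEq S] in
/-- `∂_{u_D}` is additive on the class. [cite: BalabanImbrieJaffe1988, §5.13 p.306] -/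
theorem dset_add (h𝒞 : IsSmoothClass 𝒞) (u : κ → S → ℝ) (D : Finset κ) {G G' : (S → ℝ) → ℝ} (hG : G ∈ 𝒞)
    (hG' : G' ∈ 𝒞) : dset u D (G + G') = dset u D G + dset u D G' := by
  induction D using Finset.induction_on_max generalizing G G' with
  | empty => simp only [dset_empty]
  | insert a s ha ih =>
    rw [dset_insert_max u ha, dset_insert_max u ha, dset_insert_max u ha,
      ← ih (h𝒞.fderiv_mem G hG (u a)) (h𝒞.fderiv_mem G' hG' (u a))]
    congr 1
    funext φ
    rw [fderiv_add (h𝒞.differentiable hG φ) (h𝒞.differentiable hG' φ)]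
    rfl

omit [DecidableEq S] in
/-- `∂_{u_D}` is homogeneous on the class. [cite: BalabanImbrieJaffe1988, §5.13 p.306] -/
theorem dset_smul (h𝒞 : IsSmoothClass 𝒞) (u : κ → S → ℝ) (D : Finset κ) (a : ℝ) {G : (S → ℝ) → ℝ}
    (hG : G ∈ 𝒞) : dset u D (a • G) = a • dset u D G := by
  induction D using Finset.induction_on_max generalizing G with
  | empty => simp only [dset_empty]
  | insert b s hb ih =>
    rw [dset_insert_max u hb, dset_insert_max u hb, ← ih (h𝒞.fderiv_mem G hG (u b))]
    congr 1
    funext φ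
    rw [fderiv_const_smul (h𝒞.differentiable hG φ)]
    rfl

omit [DecidableEq S] in
/-- `∂_{u_D}` of a finite sum of members. [cite: BalabanImbrieJaffe1988, §5.13 p.306] -/
theorem dset_sum (h𝒞 : IsSmoothClass 𝒞) (u : κ → S → ℝ) (D : Finset κ) {ι : Type*} (t : Finset ι)
    (G : ι → (S → ℝ) → ℝ) (hG : ∀ i ∈ t, G i ∈ 𝒞) :
    dset u D (∑ i ∈ t, G i) = ∑ i ∈ t, dset u D (G i) := by
  induction t using Finset.cons_induction with
  | empty =>
    rw [sum_empty, sum_empty]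
    have h0 := h𝒞.dset_smul u D 0 (Submodule.zero_mem 𝒞 : (0 : (S → ℝ) → ℝ) ∈ 𝒞)
    rwa [zero_smul, zero_smul] at h0
  | cons i t hi ih =>
    rw [sum_cons, sum_cons, h𝒞.dset_add u D (hG i (mem_cons_self i t))
      (Submodule.sum_mem 𝒞 fun j hj => hG j (mem_cons_of_mem hj)), ih fun j hj => hG j (mem_cons_of_mem hj)]

omit [DecidableEq S] in
/-- **`∂_{u_D}` commutes with every directional derivative** on the class.
[cite: BalabanImbrieJaffe1988, §5.13 p.306] -/
theorem dset_fderiv_comm (h𝒞 : IsSmoothClass 𝒞) (u : κ → S → ℝ) (D : Finset κ) {G : (S → ℝ) → ℝ} (hG : G ∈ 𝒞)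
    (w : S → ℝ) : (fun φ => fderiv ℝ (dset u D G) φ w) = dset u D (fun φ => fderiv ℝ G φ w) := by
  induction D using Finset.induction_on_max generalizing G with
  | empty => simp only [dset_empty]
  | insert a s ha ih =>
    rw [dset_insert_max u ha, dset_insert_max u ha, ih (h𝒞.fderiv_mem G hG (u a))]
    congr 1
    funext φ
    exact h𝒞.fderiv_fderiv_comm hG w (u a) φ

omit [DecidableEq S] in
/-- **Adding a leg anywhere = first differentiating along it**: `∂_{u_{D∪{j}}} G = ∂_{u_D}(∂_{u_j} G)` for `j ∉ D`,
whatever the position of `j` (the order of the integrations by parts is immaterial).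
[cite: BalabanImbrieJaffe1988, §5.13 p.306] -/
theorem dset_insert (h𝒞 : IsSmoothClass 𝒞) (u : κ → S → ℝ) {D : Finset κ} {j : κ} (hj : j ∉ D)
    {G : (S → ℝ) → ℝ} (hG : G ∈ 𝒞) : dset u (insert j D) G = dset u D (fun φ => fderiv ℝ G φ (u j)) := by
  induction D using Finset.induction_on_max generalizing G with
  | empty => exact dset_insert_max u (fun x hx => (notMem_empty x hx).elim) G
  | insert a s ha ih =>
    have hja' : j ≠ a := fun h => hj (h ▸ mem_insert_self a s)
    have hjs : j ∉ s := fun h => hj (mem_insert_of_mem h)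
    rcases lt_or_gt_of_ne hja' with hja | haj
    · have ha' : ∀ x ∈ insert j s, x < a := by
        intro x hx
        rcases mem_insert.1 hx with rfl | hx
        · exact hja
        · exact ha x hx
      rw [Finset.insert_comm, dset_insert_max u ha', ih hjs (h𝒞.fderiv_mem G hG (u a)), dset_insert_max u ha]
      congr 1
      funext φ
      exact h𝒞.fderiv_fderiv_comm hG (u j) (u a) φ
    · have hj' : ∀ x ∈ insert a s, x < j := by
        intro x hx
        rcases mem_insert.1 hx with rfl | hx
        · exact haj
        · exact (ha x hx).trans haj
      exact dset_insert_max u hj' G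

omit [DecidableEq S] in
/-- **`∂_{u_{D₁ ⊔ D₂}} = ∂_{u_{D₁}} ∂_{u_{D₂}}`** on the class. [cite: BalabanImbrieJaffe1988, §5.13 p.306] -/
theorem dset_union (h𝒞 : IsSmoothClass 𝒞) (u : κ → S → ℝ) {D₁ D₂ : Finset κ} (h : Disjoint D₁ D₂)
    {G : (S → ℝ) → ℝ} (hG : G ∈ 𝒞) : dset u (D₁ ∪ D₂) G = dset u D₁ (dset u D₂ G) := by
  induction D₂ using Finset.induction_on generalizing G with
  | empty => rw [union_empty, dset_empty]
  | insert j D₂ hj ih =>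
    have hj1 : j ∉ D₁ := fun h1 => disjoint_left.1 h h1 (mem_insert_self j D₂)
    have h' : Disjoint D₁ D₂ := h.mono_right (subset_insert j D₂)
    have hj' : j ∉ D₁ ∪ D₂ := by
      rw [mem_union, not_or]
      exact ⟨hj1, hj⟩
    rw [union_insert, h𝒞.dset_insert u hj' hG, ih h' (h𝒞.fderiv_mem G hG (u j)), ← h𝒞.dset_insert u hj hG]

omit [DecidableEq S] in
/-- Two legs, in either order: `∂_{u_{{j,k}}} G = ∂_{u_j} ∂_{u_k} G`. [cite: BalabanImbrieJaffe1988, §5.13 p.306] -/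
theorem dset_pair (h𝒞 : IsSmoothClass 𝒞) (u : κ → S → ℝ) {j k : κ} (hjk : j ≠ k) {G : (S → ℝ) → ℝ}
    (hG : G ∈ 𝒞) : dset u {j, k} G = fun φ => fderiv ℝ (fun ψ => fderiv ℝ G ψ (u k)) φ (u j) := by
  have hj : j ∉ ({k} : Finset κ) := by rwa [mem_singleton]
  rw [h𝒞.dset_insert u hj hG, dset_singleton]
  funext φ
  exact h𝒞.fderiv_fderiv_comm hG (u k) (u j) φ

omit [DecidableEq S] in
/-- **Linearity in one direction** (summing the direction of the leg `j ∈ D` over lattice sites):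
`∂_{u[j ↦ Σ_i c_i v_i]_D} G = Σ_i c_i ∂_{u[j ↦ v_i]_D} G`. [cite: BalabanImbrieJaffe1988, §5.13 p.306] -/
theorem dset_update_sum (h𝒞 : IsSmoothClass 𝒞) (u : κ → S → ℝ) {D : Finset κ} {j : κ} (hj : j ∈ D)
    {ι : Type*} (t : Finset ι) (c : ι → ℝ) (v : ι → S → ℝ) {G : (S → ℝ) → ℝ} (hG : G ∈ 𝒞) :
    dset (Function.update u j (∑ i ∈ t, c i • v i)) D G
      = ∑ i ∈ t, c i • dset (Function.update u j (v i)) D G := by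
  -- reduce to the leg `j` differentiated first
  have hD : D = insert j (D.erase j) := (insert_erase hj).symm
  have hj' : j ∉ D.erase j := notMem_erase j D
  have red : ∀ x : S → ℝ, dset (Function.update u j x) D G = dset u (D.erase j) (fun φ => fderiv ℝ G φ x) := by
    intro x
    conv_lhs => rw [hD, h𝒞.dset_insert _ hj' hG, Function.update_self]
    exact dset_congr (fun i hi => Function.update_of_ne (ne_of_mem_erase hi) x u) _
  rw [red]
  simp only [red]
  have e : (fun φ => fderiv ℝ G φ (∑ i ∈ t, c i • v i)) = ∑ i ∈ t, c i • fun φ => fderiv ℝ G φ (v i) := by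
    funext φ
    simp only [map_sum, map_smul, Finset.sum_apply, Pi.smul_apply]
  rw [e, h𝒞.dset_sum u _ t _ fun i _ => Submodule.smul_mem 𝒞 _ (h𝒞.fderiv_mem G hG (v i))]
  exact sum_congr rfl fun i _ => h𝒞.dset_smul u _ (c i) (h𝒞.fderiv_mem G hG (v i))

end IsSmoothClass

/-! ## §5  Coordinates -/

/-- `∂_w G = Σ_q w_q ∂_q G` (linearity of the derivative in the direction).
[cite: BalabanImbrieJaffe1988, §5.13 p.306] -/
theorem fderiv_eq_sum_single (G : (S → ℝ) → ℝ) (φ w : S → ℝ) :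
    fderiv ℝ G φ w = ∑ q, w q * fderiv ℝ G φ (Pi.single q 1) := by
  conv_lhs => rw [← Finset.univ_sum_single w]
  rw [map_sum]
  refine sum_congr rfl fun q _ => ?_
  rw [show (Pi.single q (w q) : S → ℝ) = w q • (Pi.single q (1 : ℝ) : S → ℝ) by
    rw [← Pi.single_smul', smul_eq_mul, mul_one], map_smul, smul_eq_mul]

namespace IsSmoothClass

variable {𝒞 : Submodule ℝ ((S → ℝ) → ℝ)}

/-- `∂_v ∂_w G = Σ_{p,q} v_p w_q ∂_p ∂_q G` on the class. [cite: BalabanImbrieJaffe1988, §5.13 p.306] -/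
theorem fderiv_fderiv_eq_sum (h𝒞 : IsSmoothClass 𝒞) {G : (S → ℝ) → ℝ} (hG : G ∈ 𝒞) (v w φ : S → ℝ) :
    fderiv ℝ (fun ψ => fderiv ℝ G ψ w) φ v
      = ∑ p, ∑ q, v p * w q * fderiv ℝ (fun ψ => fderiv ℝ G ψ (Pi.single q 1)) φ (Pi.single p 1) := by
  have e : (fun ψ => fderiv ℝ G ψ w) = fun ψ => ∑ q, w q * fderiv ℝ G ψ (Pi.single q 1) := by
    funext ψ
    exact fderiv_eq_sum_single G ψ w
  have hdiff : ∀ q, HasFDerivAt (fun ψ => w q * fderiv ℝ G ψ (Pi.single q 1))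
      (w q • fderiv ℝ (fun ψ => fderiv ℝ G ψ (Pi.single q 1)) φ) φ := fun q =>
    ((h𝒞.differentiable (h𝒞.fderiv_mem G hG _) φ).hasFDerivAt).const_mul (w q)
  rw [e, (HasFDerivAt.fun_sum fun q _ => hdiff q).fderiv]
  simp only [FunLike.coe_sum, Finset.sum_apply, FunLike.coe_smul, Pi.smul_apply, smul_eq_mul]
  rw [sum_comm]
  refine sum_congr rfl fun q _ => ?_
  rw [fderiv_eq_sum_single _ φ v, mul_sum]
  refine sum_congr rfl fun p _ => ?_
  ring

end IsSmoothClass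

end Literature.MathematicalPhysics.QuantumFieldTheory.BalabanImbrieJaffe1984to88.BIJ88SmoothClassCalculus306
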